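import Summits.FinalStateConjecture.FinalStateConjecture.Theorems.PhotonSphereChannelsExteriorEnergyRW

/-!
# Route PhotonSphereChannels — a coercive Morawetz multiplier for every fixed Regge–Wheeler mode

Helper file for the registered sub-goal `stub_rwLocalEnergyDecay` (integrated local energy decay) of stub
`stub_outgoingEnergyExhaustion` (H4) of line `isolated-kerr-connected-hull` (crux stmt-FinalStateConjecture-14075).
In the multiplier identity `∂ₜP − ∂ₓQ = −B` of `…RMorawetzIdentity` with `β = ½ f′` the bulk is the quadratic form
`B = f′ u_x² + (½ f″ + f V − 2 φ) u u_x + (½ f′ V − φ′) u²` in `(u_x, u)`.  For `V = V_{s,ℓ} ∘ r` along a tortoise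
radius function (`s ≤ 2`, `s ≤ ℓ`) we exhibit explicit weights making it pointwise COERCIVE on the whole line: as
functions of the area radius `ρ = r(x)` (`d/dx = (1 − 2M/ρ) d/dρ`), `f = F ∘ r`, `F = (ρ − 3M)/ρ` (vanishing at the
PHOTON SPHERE, `|F| ≤ 1`), `f′ = A ∘ r`, `A = 3M(ρ−2M)/ρ³ > 0` (`A² ≤ (9/16)V`), `f″ = A₂ ∘ r`, `φ = Φ ∘ r`,
`Φ = ½ F V + ⅛ A₂` (half of the cross term integrated by parts); the form becomes `A u_x² + ¼ A₂ u u_x + C u²` and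
(`mzDet_pos`) `A C − (A₂/8)² = (ρ−2M)² Ñ/ρ¹⁰ > 0` on `ρ > 2M`: affine in `λ = ℓ(ℓ+1)` with slope
`3M(ρ−2M)²(ρ−3M)²/ρ⁹ ≥ 0`, and positive at the base cases `(s,λ) = (0,0), (1,2), (2,6)` by explicit SOS certificates
in `t = ρ − 2M`.  Hence (`quadForm_ge`) the form dominates `m(x)(u_x² + u²)`, `m = (AC − A₂²/64)/(A + C) ∘ r > 0`
continuous (`RW.stub_rwMorawetzWeight`): no trapping loss for a fixed mode and no loss at the horizon.  The constants
come from an exact rational search (worker notes `stub_rwLocalEnergyDecay.md`). [folklore]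
-/

namespace Summit.FinalStateConjecture.FinalStateConjecture.Theorems

-- every `Summit.FinalStateConjecture.FinalStateConjecture.…` name repeats the summit = sub-problem
-- segment (D-0017 layout), as in every landed `…Theorems` file of this route
set_option linter.dupNamespace false

open Set Filter Topology
open Literature.Geometry.Lorentzian Literature.Geometry.Lorentzian.ReggeWheeler

noncomputable section

namespace RW

/-! ### The radial weights (functions of the area radius `ρ`, parameters `M`, `lam = ℓ(ℓ+1)`, `sig = 2M(1−s²)`) -/

section Radial

variable {M lam sig ρ : ℝ}

/-- The Morawetz weight `F(ρ) = (ρ − 3M)/ρ` (vanishes at the photon sphere). -/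
def mzF (M ρ : ℝ) : ℝ := (ρ - 3 * M) / ρ

/-- `A = F_ρ · (1 − 2M/ρ) = 3M(ρ − 2M)/ρ³` (`= f′` along the tortoise line). -/
def mzA (M ρ : ℝ) : ℝ := 3 * M * (ρ - 2 * M) / ρ ^ 3

/-- `A₂ = A_ρ · (1 − 2M/ρ) = 6M(3M − ρ)(ρ − 2M)/ρ⁵` (`= f″` along the tortoise line). -/
def mzA2 (M ρ : ℝ) : ℝ := 6 * M * (3 * M - ρ) * (ρ - 2 * M) / ρ ^ 5

/-- The model potential `(ρ − 2M)(lam ρ + sig)/ρ⁴ = (1 − 2M/ρ)(lam/ρ² + sig/ρ³)`. -/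
def mzV (M lam sig ρ : ℝ) : ℝ := (ρ - 2 * M) * (lam * ρ + sig) / ρ ^ 4

/-- `Φ = ½ F V + ⅛ A₂ = (ρ − 2M)(ρ − 3M)(2 lam ρ + 2 sig − 3M)/(4ρ⁵)`. -/
def mzΦ (M lam sig ρ : ℝ) : ℝ := (ρ - 2 * M) * (ρ - 3 * M) * (2 * lam * ρ + 2 * sig - 3 * M) / (4 * ρ ^ 5)

/-- `Φ_ρ = dΦ/dρ`. -/
def mzΦρ (M lam sig ρ : ℝ) : ℝ :=
  (lam * ρ * (-4 * ρ ^ 2 + 30 * M * ρ - 48 * M ^ 2) + sig * (-6 * ρ ^ 2 + 40 * M * ρ - 60 * M ^ 2)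
    + (9 * M * ρ ^ 2 - 60 * M ^ 2 * ρ + 90 * M ^ 3)) / (4 * ρ ^ 6)

/-- The `u²`-coefficient `C = ½ A V − (1 − 2M/ρ) Φ_ρ`, in closed form. -/
def mzC (M lam sig ρ : ℝ) : ℝ :=
  (ρ - 2 * M) * (4 * lam * ρ * (ρ - 3 * M) ^ 2 + 2 * sig * (3 * ρ ^ 2 - 17 * M * ρ + 24 * M ^ 2)
    - 3 * M * (3 * ρ ^ 2 - 20 * M * ρ + 30 * M ^ 2)) / (4 * ρ ^ 7)

/-- The discriminant `A C − (A₂/8)²` of the bulk form `A p² + ¼ A₂ p q + C q²`. -/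
def mzDet (M lam sig ρ : ℝ) : ℝ := mzA M ρ * mzC M lam sig ρ - (mzA2 M ρ / 8) ^ 2

/-- `dF/dρ = 3M/ρ²`. -/
theorem hasDerivAt_mzF (hρ : ρ ≠ 0) : HasDerivAt (mzF M) (3 * M / ρ ^ 2) ρ := by
  have h := ((hasDerivAt_id' ρ).sub_const (3 * M)).fun_div (hasDerivAt_id' ρ) hρ
  exact h.congr_deriv (by field_simp; ring)

/-- `A = F_ρ (1 − 2M/ρ)`. -/
theorem mzA_eq (hρ : ρ ≠ 0) : mzA M ρ = 3 * M / ρ ^ 2 * (1 - 2 * M / ρ) := by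
  unfold mzA
  field_simp

/-- `dA/dρ = 6M(3M − ρ)/ρ⁴`. -/
theorem hasDerivAt_mzA (hρ : ρ ≠ 0) : HasDerivAt (mzA M) (6 * M * (3 * M - ρ) / ρ ^ 4) ρ := by
  have h := (((hasDerivAt_id' ρ).sub_const (2 * M)).const_mul (3 * M)).fun_div (hasDerivAt_pow 3 ρ)
    (pow_ne_zero 3 hρ)
  exact h.congr_deriv (by field_simp; ring)

/-- `A₂ = A_ρ (1 − 2M/ρ)`. -/
theorem mzA2_eq (hρ : ρ ≠ 0) : mzA2 M ρ = 6 * M * (3 * M - ρ) / ρ ^ 4 * (1 - 2 * M / ρ) := by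
  unfold mzA2
  field_simp

/-- `dΦ/dρ = Φ_ρ`. -/
theorem hasDerivAt_mzΦ (hρ : ρ ≠ 0) : HasDerivAt (mzΦ M lam sig) (mzΦρ M lam sig ρ) ρ := by
  have h1 : HasDerivAt (fun ρ : ℝ => ρ - 2 * M) 1 ρ := (hasDerivAt_id' ρ).sub_const _
  have h2 : HasDerivAt (fun ρ : ℝ => ρ - 3 * M) 1 ρ := (hasDerivAt_id' ρ).sub_const _
  have h3 : HasDerivAt (fun ρ : ℝ => 2 * lam * ρ + 2 * sig - 3 * M) (2 * lam) ρ := by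
    simpa using (((hasDerivAt_id' ρ).const_mul (2 * lam)).add_const (2 * sig)).sub_const (3 * M)
  have h4 : HasDerivAt (fun ρ : ℝ => 4 * ρ ^ 5) (4 * (5 * ρ ^ 4)) ρ := by
    simpa using (hasDerivAt_pow 5 ρ).const_mul 4
  have h := ((h1.fun_mul h2).fun_mul h3).fun_div h4 (by positivity)
  refine h.congr_deriv ?_
  unfold mzΦρ
  field_simp
  ring

/-- The cross-term bookkeeping: `½ A₂ + F V − 2 Φ = ¼ A₂`. -/
theorem mz_cross (hρ : ρ ≠ 0) :
    1 / 2 * mzA2 M ρ + mzF M ρ * mzV M lam sig ρ - 2 * mzΦ M lam sig ρ = 1 / 4 * mzA2 M ρ := by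
  unfold mzA2 mzF mzV mzΦ
  field_simp
  ring

/-- The `u²`-coefficient: `½ A V − (1 − 2M/ρ) Φ_ρ = C`. -/
theorem mz_coeff (hρ : ρ ≠ 0) :
    1 / 2 * mzA M ρ * mzV M lam sig ρ - mzΦρ M lam sig ρ * (1 - 2 * M / ρ) = mzC M lam sig ρ := by
  unfold mzA mzV mzΦρ mzC
  field_simp
  ring

/-- The model potential is the Regge–Wheeler potential: `V_{s,ℓ}(ρ) = mzV M (ℓ(ℓ+1)) (2M(1−s²)) ρ`. -/
theorem rwPotential_eq_mzV (hρ : ρ ≠ 0) (s ℓ : ℕ) :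
    rwPotential M s ℓ ρ = mzV M ((ℓ : ℝ) * ((ℓ : ℝ) + 1)) ((1 - (s : ℝ) ^ 2) * (2 * M)) ρ := by
  unfold rwPotential mzV
  field_simp

/-- The discriminant is affine in `lam` with the manifestly non-negative slope `3M(ρ−2M)²(ρ−3M)²/ρ⁹`. -/
theorem mzDet_lam (hρ : ρ ≠ 0) (lam₀ : ℝ) :
    mzDet M lam sig ρ
      = mzDet M lam₀ sig ρ + (lam - lam₀) * (3 * M * (ρ - 2 * M) ^ 2 * (ρ - 3 * M) ^ 2 / ρ ^ 9) := by
  unfold mzDet mzA mzC mzA2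
  field_simp
  ring

/-- Base case `s = 0`, `λ = 0`. -/
theorem mzDet_base₀ (hρ : ρ ≠ 0) :
    mzDet M 0 (2 * M) ρ = (ρ - 2 * M) ^ 2 * M ^ 2 * (27 * ρ ^ 2 - 42 * M * ρ - 9 * M ^ 2) / (16 * ρ ^ 10) := by
  unfold mzDet mzA mzC mzA2
  field_simp
  ring

/-- Base case `s = 1`, `λ = 2`. -/
theorem mzDet_base₁ (hρ : ρ ≠ 0) :
    mzDet M 2 0 ρ = (ρ - 2 * M) ^ 2 * M
      * (96 * ρ ^ 3 - 693 * M * ρ ^ 2 + 1638 * M ^ 2 * ρ - 1161 * M ^ 3) / (16 * ρ ^ 10) := by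
  unfold mzDet mzA mzC mzA2
  field_simp
  ring

/-- Base case `s = 2`, `λ = 6`. -/
theorem mzDet_base₂ (hρ : ρ ≠ 0) :
    mzDet M 6 (-(6 * M)) ρ = (ρ - 2 * M) ^ 2 * M
      * (288 * ρ ^ 3 - 2277 * M * ρ ^ 2 + 5814 * M ^ 2 * ρ - 4617 * M ^ 3) / (16 * ρ ^ 10) := by
  unfold mzDet mzA mzC mzA2
  field_simp
  ring

/-- Positivity certificate, `s = 0`: `27ρ² − 42Mρ − 9M² = 27t² + 66Mt + 15M²`, `t = ρ − 2M`. -/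
theorem mzPoly₀_pos (hM : 0 < M) (hρ : 2 * M < ρ) : 0 < 27 * ρ ^ 2 - 42 * M * ρ - 9 * M ^ 2 := by
  have ht : 0 < ρ - 2 * M := by linarith
  have key : 27 * ρ ^ 2 - 42 * M * ρ - 9 * M ^ 2
      = 27 * (ρ - 2 * M) ^ 2 + 66 * M * (ρ - 2 * M) + 15 * M ^ 2 := by ring
  rw [key]
  positivity

/-- Positivity certificate, `s = 1`: `39(t−M)²(2t+M) + 18t³ + 18M²t + 72M³`, `t = ρ − 2M`. -/
theorem mzPoly₁_pos (hM : 0 < M) (hρ : 2 * M < ρ) :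
    0 < 96 * ρ ^ 3 - 693 * M * ρ ^ 2 + 1638 * M ^ 2 * ρ - 1161 * M ^ 3 := by
  have ht : 0 < ρ - 2 * M := by linarith
  have key : 96 * ρ ^ 3 - 693 * M * ρ ^ 2 + 1638 * M ^ 2 * ρ - 1161 * M ^ 3
      = 39 * (ρ - 2 * M - M) ^ 2 * (2 * (ρ - 2 * M) + M)
        + (18 * (ρ - 2 * M) ^ 3 + 18 * M ^ 2 * (ρ - 2 * M) + 72 * M ^ 3) := by ring
  rw [key]
  positivity

/-- Positivity certificate, `s = 2`: `(t−9M/8)²(288t+99M) + (81/4)M²t + (5229/64)M³`, `t = ρ − 2M`. -/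
theorem mzPoly₂_pos (hM : 0 < M) (hρ : 2 * M < ρ) :
    0 < 288 * ρ ^ 3 - 2277 * M * ρ ^ 2 + 5814 * M ^ 2 * ρ - 4617 * M ^ 3 := by
  have ht : 0 < ρ - 2 * M := by linarith
  have key : 288 * ρ ^ 3 - 2277 * M * ρ ^ 2 + 5814 * M ^ 2 * ρ - 4617 * M ^ 3
      = (ρ - 2 * M - 9 * M / 8) ^ 2 * (288 * (ρ - 2 * M) + 99 * M)
        + (81 / 4 * M ^ 2 * (ρ - 2 * M) + 5229 / 64 * M ^ 3) := by ring
  rw [key]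
  positivity

/-- `A > 0` outside the horizon. -/
theorem mzA_pos (hM : 0 < M) (hρ : 2 * M < ρ) : 0 < mzA M ρ :=
  div_pos (mul_pos (mul_pos three_pos hM) (sub_pos.2 hρ)) (pow_pos (by linarith) 3)

/-- **The discriminant is positive** outside the horizon for every admissible mode: `s ≤ 2`, `s ≤ ℓ`,
`lam = ℓ(ℓ+1)`, `sig = 2M(1 − s²)`. -/
theorem mzDet_pos (hM : 0 < M) (hρ : 2 * M < ρ) {s ℓ : ℕ} (hs : s ≤ 2) (hsℓ : s ≤ ℓ) :
    0 < mzDet M ((ℓ : ℝ) * ((ℓ : ℝ) + 1)) ((1 - (s : ℝ) ^ 2) * (2 * M)) ρ := by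
  have hρpos : 0 < ρ := by linarith
  have hρ0 : ρ ≠ 0 := hρpos.ne'
  have ht : 0 < ρ - 2 * M := by linarith
  have hslope : 0 ≤ 3 * M * (ρ - 2 * M) ^ 2 * (ρ - 3 * M) ^ 2 / ρ ^ 9 := by positivity
  have hℓ : (s : ℝ) ≤ ℓ := by exact_mod_cast hsℓ
  have hℓ0 : (0 : ℝ) ≤ ℓ := by exact_mod_cast Nat.zero_le ℓ
  interval_cases s
  · -- `s = 0`: base `lam₀ = 0`
    have hlam : (0 : ℝ) ≤ (ℓ : ℝ) * ((ℓ : ℝ) + 1) - 0 := by nlinarith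
    rw [mzDet_lam hρ0 0]
    have hb : 0 < mzDet M 0 ((1 - ((0 : ℕ) : ℝ) ^ 2) * (2 * M)) ρ := by
      have e : (1 - ((0 : ℕ) : ℝ) ^ 2) * (2 * M) = 2 * M := by push_cast; ring
      rw [e, mzDet_base₀ hρ0]
      have := mzPoly₀_pos hM hρ
      positivity
    exact add_pos_of_pos_of_nonneg hb (mul_nonneg hlam hslope)
  · -- `s = 1`: base `lam₀ = 2`
    have hℓ1 : (1 : ℝ) ≤ ℓ := by exact_mod_cast hℓ
    have hlam : (0 : ℝ) ≤ (ℓ : ℝ) * ((ℓ : ℝ) + 1) - 2 := by nlinarith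
    rw [mzDet_lam hρ0 2]
    have hb : 0 < mzDet M 2 ((1 - ((1 : ℕ) : ℝ) ^ 2) * (2 * M)) ρ := by
      have e : (1 - ((1 : ℕ) : ℝ) ^ 2) * (2 * M) = 0 := by push_cast; ring
      rw [e, mzDet_base₁ hρ0]
      have := mzPoly₁_pos hM hρ
      positivity
    exact add_pos_of_pos_of_nonneg hb (mul_nonneg hlam hslope)
  · -- `s = 2`: base `lam₀ = 6`
    have hℓ2 : (2 : ℝ) ≤ ℓ := by exact_mod_cast hℓ
    have hlam : (0 : ℝ) ≤ (ℓ : ℝ) * ((ℓ : ℝ) + 1) - 6 := by nlinarith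
    rw [mzDet_lam hρ0 6]
    have hb : 0 < mzDet M 6 ((1 - ((2 : ℕ) : ℝ) ^ 2) * (2 * M)) ρ := by
      have e : (1 - ((2 : ℕ) : ℝ) ^ 2) * (2 * M) = -(6 * M) := by push_cast; ring
      rw [e, mzDet_base₂ hρ0]
      have := mzPoly₂_pos hM hρ
      positivity
    exact add_pos_of_pos_of_nonneg hb (mul_nonneg hlam hslope)

/-- Hence also `C > 0` outside the horizon for every admissible mode. -/
theorem mzC_pos (hM : 0 < M) (hρ : 2 * M < ρ) {s ℓ : ℕ} (hs : s ≤ 2) (hsℓ : s ≤ ℓ) :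
    0 < mzC M ((ℓ : ℝ) * ((ℓ : ℝ) + 1)) ((1 - (s : ℝ) ^ 2) * (2 * M)) ρ := by
  have ha := mzA_pos hM hρ
  have hdet := mzDet_pos hM hρ hs hsℓ
  unfold mzDet at hdet
  by_contra h
  push Not at h
  nlinarith [sq_nonneg (mzA2 M ρ / 8), mul_nonpos_iff.2 (Or.inl ⟨ha.le, h⟩)]

/-- In every admissible mode `lam ρ + sig ≥ 2M` outside the horizon (`lam = ℓ(ℓ+1)`, `sig = 2M(1−s²)`). -/
theorem two_mul_le_lam_mul_add (hM : 0 < M) (hρ : 2 * M < ρ) {s ℓ : ℕ} (hs : s ≤ 2) (hsℓ : s ≤ ℓ) :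
    2 * M ≤ (ℓ : ℝ) * ((ℓ : ℝ) + 1) * ρ + (1 - (s : ℝ) ^ 2) * (2 * M) := by
  have hℓ : (s : ℝ) ≤ ℓ := by exact_mod_cast hsℓ
  have hℓ0 : (0 : ℝ) ≤ ℓ := by exact_mod_cast Nat.zero_le ℓ
  have hρ0 : 0 ≤ ρ := by linarith
  interval_cases s
  · push_cast
    nlinarith [mul_nonneg (mul_nonneg hℓ0 (by linarith : (0 : ℝ) ≤ (ℓ : ℝ) + 1)) hρ0]
  · have hℓ1 : (1 : ℝ) ≤ ℓ := by exact_mod_cast hℓ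
    push_cast
    have h2 : (2 : ℝ) ≤ (ℓ : ℝ) * ((ℓ : ℝ) + 1) := by nlinarith
    nlinarith [mul_le_mul_of_nonneg_right h2 hρ0]
  · have hℓ2 : (2 : ℝ) ≤ ℓ := by exact_mod_cast hℓ
    push_cast
    have h6 : (6 : ℝ) ≤ (ℓ : ℝ) * ((ℓ : ℝ) + 1) := by nlinarith
    nlinarith [mul_le_mul_of_nonneg_right h6 hρ0]

/-- `|F| ≤ 1` outside the horizon. -/
theorem abs_mzF_le (hM : 0 < M) (hρ : 2 * M < ρ) : |mzF M ρ| ≤ 1 := by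
  have hρpos : 0 < ρ := by linarith
  unfold mzF
  rw [abs_le, le_div_iff₀ hρpos, div_le_iff₀ hρpos]
  constructor <;> linarith

/-- `A² ≤ (9/16) V_{s,ℓ}` outside the horizon (`(ρ − 4M)² ≥ 0` and `lam ρ + sig ≥ 2M`). -/
theorem mzA_sq_le (hM : 0 < M) (hρ : 2 * M < ρ) {s ℓ : ℕ} (hs : s ≤ 2) (hsℓ : s ≤ ℓ) :
    mzA M ρ ^ 2 ≤ 9 / 16 * rwPotential M s ℓ ρ := by
  have hρpos : 0 < ρ := by linarith
  have hρ0 : ρ ≠ 0 := hρpos.ne'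
  have ht : 0 < ρ - 2 * M := by linarith
  have hL := two_mul_le_lam_mul_add hM hρ hs hsℓ
  rw [rwPotential_eq_mzV hρ0]
  unfold mzA mzV
  rw [div_pow, div_le_iff₀ (by positivity)]
  rw [show 9 / 16 * ((ρ - 2 * M) * ((ℓ : ℝ) * ((ℓ : ℝ) + 1) * ρ + (1 - (s : ℝ) ^ 2) * (2 * M)) / ρ ^ 4)
      * (ρ ^ 3) ^ 2
      = 9 / 16 * ((ρ - 2 * M) * ((ℓ : ℝ) * ((ℓ : ℝ) + 1) * ρ + (1 - (s : ℝ) ^ 2) * (2 * M)) * ρ ^ 2) by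
    field_simp]
  have h1 : (3 * M * (ρ - 2 * M)) ^ 2 ≤ 9 / 16 * ((ρ - 2 * M) * (2 * M) * ρ ^ 2) := by
    nlinarith [sq_nonneg (ρ - 4 * M), mul_pos hM ht]
  have h2 : (ρ - 2 * M) * (2 * M) * ρ ^ 2
      ≤ (ρ - 2 * M) * ((ℓ : ℝ) * ((ℓ : ℝ) + 1) * ρ + (1 - (s : ℝ) ^ 2) * (2 * M)) * ρ ^ 2 := by
    have := mul_le_mul_of_nonneg_left hL ht.le
    nlinarith [mul_le_mul_of_nonneg_right this (sq_nonneg ρ)]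
  nlinarith

/-- **Coercivity of a `2 × 2` form from its discriminant**: for `a > 0` and `ac − b² > 0`,
`a p² + 2b p q + c q² ≥ ((ac − b²)/(a + c)) (p² + q²)` (the smaller eigenvalue is at least `det/trace`). -/
theorem quadForm_ge {a b c : ℝ} (ha : 0 < a) (hdet : 0 < a * c - b ^ 2) (p q : ℝ) :
    (a * c - b ^ 2) / (a + c) * (p ^ 2 + q ^ 2) ≤ a * p ^ 2 + 2 * b * (q * p) + c * q ^ 2 := by
  have hc : 0 < c := by
    by_contra h
    push Not at h
    nlinarith [sq_nonneg b, mul_nonpos_iff.2 (Or.inl ⟨ha.le, h⟩)]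
  have hac : 0 < a + c := by linarith
  set μ : ℝ := (a * c - b ^ 2) / (a + c) with hμdef
  have hμ : μ * (a + c) = a * c - b ^ 2 := by
    rw [hμdef, div_mul_cancel₀ _ hac.ne']
  have hkey : (a - μ) * (c - μ) = b ^ 2 + μ ^ 2 := by linear_combination (-1 : ℝ) * hμ
  have hd : 0 < a - μ := by
    have : (a - μ) * (a + c) = a ^ 2 + b ^ 2 := by linear_combination (-1 : ℝ) * hμ
    have h2 : 0 < a ^ 2 + b ^ 2 := by positivity
    by_contra h
    push Not at h
    nlinarith [mul_nonpos_iff.2 (Or.inl ⟨hac.le, h⟩)]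
  have hexp : (a - μ) * (a * p ^ 2 + 2 * b * (q * p) + c * q ^ 2) - (a - μ) * (μ * (p ^ 2 + q ^ 2))
      = ((a - μ) * p + b * q) ^ 2 + μ ^ 2 * q ^ 2 := by linear_combination q ^ 2 * hkey
  have hnn : 0 ≤ ((a - μ) * p + b * q) ^ 2 + μ ^ 2 * q ^ 2 := by positivity
  exact le_of_mul_le_mul_left (by linarith) hd

end Radial

/-! ### Along a tortoise radius function: the Morawetz weights on the line -/

section Line

variable {M : ℝ} {r : ℝ → ℝ} {xc : ℝ}

/-- Chain rule along a tortoise radius function: `d/dx G(r x) = G′(r x) (1 − 2M/r x)`. -/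
theorem hasDerivAt_comp_tortoise (hr : IsTortoiseRadius M r xc) {G : ℝ → ℝ} {G' : ℝ} {x : ℝ}
    (hG : HasDerivAt G G' (r x)) : HasDerivAt (fun y => G (r y)) (G' * (1 - 2 * M / r x)) x :=
  hG.comp x (hr.hasDerivAt x)

/-- A quotient `N(r x) / (c · (r x)^k)` with continuous numerator is continuous along `r` (`r > 0`). -/
theorem continuous_div_pow_tortoise (hr : IsTortoiseRadius M r xc) {N : ℝ → ℝ}
    (hN : Continuous fun x => N (r x)) (c : ℝ) (hc : c ≠ 0) (k : ℕ) :
    Continuous fun x => N (r x) / (c * r x ^ k) :=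
  hN.div (continuous_const.mul (hr.continuous.pow k)) fun x =>
    mul_ne_zero hc (pow_ne_zero k (hr.pos x).ne')

/-- **Registered sub-goal `stub_rwMorawetzWeight` of `stub_rwLocalEnergyDecay`** (crux
stmt-FinalStateConjecture-14075, line `isolated-kerr-connected-hull`): **the coercive Morawetz weights along a
tortoise radius function.**  For `s ≤ 2`, `s ≤ ℓ` there are `C¹` weights `f, f′, φ` of the tortoise coordinate
(with `f″ = (f′)′`, `φ′` continuous) and a continuous `m > 0` such that `|f| ≤ 1`, `f′² ≤ (9/16) V` and, for all
`x, p, q`, `m(x)(p² + q²) ≤ f′ p² + (½ f″ + f V − 2φ) q p + (½ f′ V − φ′) q²`, `V = V_{s,ℓ} ∘ r` — i.e. the bulk of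
the multiplier identity with `β = ½ f′` is pointwise coercive in `(u_x, u)`. [folklore] -/
theorem stub_rwMorawetzWeight :
    ∀ (M : ℝ) (r : ℝ → ℝ) (xc : ℝ), ReggeWheeler.IsTortoiseRadius M r xc → ∀ (s ℓ : ℕ), s ≤ 2 → s ≤ ℓ →
      ∃ f f' f'' φ φ' m : ℝ → ℝ,
        (∀ x, HasDerivAt f (f' x) x) ∧ (∀ x, HasDerivAt f' (f'' x) x) ∧ (∀ x, HasDerivAt φ (φ' x) x) ∧
        Continuous f'' ∧ Continuous φ' ∧ Continuous m ∧ (∀ x, 0 < m x) ∧ (∀ x, |f x| ≤ 1) ∧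
        (∀ x, f' x ^ 2 ≤ 9 / 16 * ReggeWheeler.linePotential M s ℓ r x) ∧
        ∀ x p q : ℝ, m x * (p ^ 2 + q ^ 2)
          ≤ f' x * p ^ 2
            + (1 / 2 * f'' x + f x * ReggeWheeler.linePotential M s ℓ r x - 2 * φ x) * (q * p)
            + (1 / 2 * f' x * ReggeWheeler.linePotential M s ℓ r x - φ' x) * q ^ 2 := by
  intro M r xc hr s ℓ hs hsℓ
  have hM := hr.mass_pos
  set lam : ℝ := (ℓ : ℝ) * ((ℓ : ℝ) + 1) with hlam
  set sig : ℝ := (1 - (s : ℝ) ^ 2) * (2 * M) with hsig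
  have hr0 : ∀ x, r x ≠ 0 := fun x => (hr.pos x).ne'
  have hr2 : ∀ x, 2 * M < r x := hr.two_mul_lt
  have hrc := hr.continuous
  have hV : ∀ x, linePotential M s ℓ r x = mzV M lam sig (r x) := fun x =>
    rwPotential_eq_mzV (hr0 x) s ℓ
  have hpos : ∀ x, 0 < mzA M (r x) ∧ 0 < mzC M lam sig (r x) ∧ 0 < mzDet M lam sig (r x) := fun x =>
    ⟨mzA_pos hM (hr2 x), mzC_pos hM (hr2 x) hs hsℓ, mzDet_pos hM (hr2 x) hs hsℓ⟩
  -- continuity of the radial weights along `r`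
  have hA : Continuous fun x => mzA M (r x) := by
    simpa [mzA] using continuous_div_pow_tortoise hr (N := fun ρ => 3 * M * (ρ - 2 * M))
      (by fun_prop) 1 one_ne_zero 3
  have hA2 : Continuous fun x => mzA2 M (r x) := by
    simpa [mzA2] using continuous_div_pow_tortoise hr (N := fun ρ => 6 * M * (3 * M - ρ) * (ρ - 2 * M))
      (by fun_prop) 1 one_ne_zero 5
  have hC : Continuous fun x => mzC M lam sig (r x) :=
    continuous_div_pow_tortoise hr (N := fun ρ => (ρ - 2 * M) * (4 * lam * ρ * (ρ - 3 * M) ^ 2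
      + 2 * sig * (3 * ρ ^ 2 - 17 * M * ρ + 24 * M ^ 2) - 3 * M * (3 * ρ ^ 2 - 20 * M * ρ + 30 * M ^ 2)))
      (by fun_prop) 4 (by norm_num) 7
  have hΦρ : Continuous fun x => mzΦρ M lam sig (r x) :=
    continuous_div_pow_tortoise hr (N := fun ρ => lam * ρ * (-4 * ρ ^ 2 + 30 * M * ρ - 48 * M ^ 2)
      + sig * (-6 * ρ ^ 2 + 40 * M * ρ - 60 * M ^ 2) + (9 * M * ρ ^ 2 - 60 * M ^ 2 * ρ + 90 * M ^ 3))
      (by fun_prop) 4 (by norm_num) 6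
  have hD : Continuous fun x => 1 - 2 * M / r x := continuous_const.sub (continuous_const.div hrc hr0)
  refine ⟨fun x => mzF M (r x), fun x => mzA M (r x), fun x => mzA2 M (r x),
    fun x => mzΦ M lam sig (r x), fun x => mzΦρ M lam sig (r x) * (1 - 2 * M / r x),
    fun x => mzDet M lam sig (r x) / (mzA M (r x) + mzC M lam sig (r x)),
    fun x => ?_, fun x => ?_, fun x => ?_, hA2, hΦρ.mul hD, ?_, fun x => ?_, fun x => abs_mzF_le hM (hr2 x),
    fun x => mzA_sq_le hM (hr2 x) hs hsℓ, fun x p q => ?_⟩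
  · exact (hasDerivAt_comp_tortoise hr (hasDerivAt_mzF (M := M) (hr0 x))).congr_deriv
      (mzA_eq (hr0 x)).symm
  · exact (hasDerivAt_comp_tortoise hr (hasDerivAt_mzA (M := M) (hr0 x))).congr_deriv
      (mzA2_eq (hr0 x)).symm
  · exact hasDerivAt_comp_tortoise hr (hasDerivAt_mzΦ (hr0 x))
  · refine (((hA.mul hC).sub ((hA2.div_const 8).pow 2)).div (hA.add hC) fun x => ?_)
    exact (add_pos (hpos x).1 (hpos x).2.1).ne'
  · exact div_pos (hpos x).2.2 (add_pos (hpos x).1 (hpos x).2.1)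
  · beta_reduce
    rw [hV x, mz_cross (hr0 x), mz_coeff (hr0 x)]
    have key := quadForm_ge (b := mzA2 M (r x) / 8) (hpos x).1
      (by have h := (hpos x).2.2; unfold mzDet at h; exact h) p q
    have e : 2 * (mzA2 M (r x) / 8) * (q * p) = 1 / 4 * mzA2 M (r x) * (q * p) := by ring
    unfold mzDet
    rw [e] at key
    exact key

end Line

end RW

end

end Summit.FinalStateConjecture.FinalStateConjecture.Theorems
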